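import Mathlib
import Literature.NumberTheory.Transcendental.GelfondExpLogConjecture
import Literature.NumberTheory.Transcendental.LindemannWeierstrassProofs
import HarnessLib
import HarnessLib.Audit

/-!
# Gel'fond's exp–log conjecture implies the "tower atom" of route `Schanuel/ToricSector`

Topic `Literature/NumberTheory/Transcendental`. One PROVED conditional theorem (no new named fact,
no new conjecture), filed while grounding route `Schanuel/ToricSector`, crux `TowerAtom`
(`stmt-Schanuel-12029`, `Summit.Schanuel.Schanuel.Theses.ToricSector.TowerAtom`):

* `towerAtom_of_gelfondExpLogConjecture` — the registered open statement
  `Literature.NumberTheory.Transcendental.GelfondExpLogConjecture` (Waldschmidt, LNM 402 (1974),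
  Conjecture 7.5.3: for `ℚ`-linearly independent algebraic `αᵢ` and `ℚ`-linearly independent
  logarithms of algebraic numbers `ℓⱼ`, the numbers `e^{αᵢ}, ℓⱼ` are algebraically independent)
  implies, at `n = m = 1`, the tower atom: for algebraic `β ≠ 0`, algebraic `c ≠ 0` and rational
  `q`, the number `e^{c·e^β − qβ}` is not algebraic (equivalently `c·e^β − qβ` is not a logarithm
  of an algebraic number). Proof: if `ℓ := c·e^β − qβ ∈ L` then `ℓ ≠ 0` (else `e^β = qβ/c ∈ ℚ̄`,
  contradicting Hermite–Lindemann, tree theorem `transcendental_exp_holds`), so the conjecture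
  makes `e^β, ℓ` algebraically independent over `ℚ`, hence over the subalgebra `ℚ̄` of algebraic
  numbers (Mathlib `AlgebraicIndependent.subalgebraAlgebraicClosure`), whereas
  `ℓ − c·e^β + qβ = 0` is a non-trivial `ℚ̄`-polynomial relation. The statement proved is
  VERBATIM the body of the route declaration `TowerAtom` (there `∀ (β c : ℂ) (q : ℚ), …`), so a
  prover may cite it as `TowerAtom ⇐ GelfondExpLogConjecture ⇐ Schanuel` (the latter implication
  is Murty–Rath 2014, Ch. 21, Exercise 4; not formalised here).

## References

* [Waldschmidt1974LNM402] M. Waldschmidt, *Nombres transcendants*, LNM 402 (1974), §7.5,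
  Conjecture 7.5.3 (the conjecture; tree `GelfondExpLogConjecture`).
* [MurtyRath2014] M. R. Murty, P. Rath, *Transcendental Numbers* (2014), Ch. 21, Exercises 4–5
  (Schanuel ⟹ the conjecture; algebraic independence over `ℚ` iff over `ℚ̄`).
-/

noncomputable section

namespace Literature.NumberTheory.Transcendental

open Complex

/-- A one-element family `![z]` is `ℚ`-linearly independent if `z ≠ 0`: an instance of Mathlib's
`linearIndependent_unique_iff`; deprecated restatement (dedup-01122, 2026-08-16). [folklore] -/
@[deprecated linearIndependent_unique_iff (since := "2026-08-16")]
theorem linearIndependent_vecSingle {z : ℂ} (hz : z ≠ 0) :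
    LinearIndependent ℚ (![z] : Fin 1 → ℂ) :=
  linearIndependent_unique_iff.mpr hz

/-- **Gel'fond's exp–log conjecture (Waldschmidt 1974, Conj. 7.5.3) at `n = m = 1` implies the
tower atom of route `Schanuel/ToricSector`**: for algebraic `β ≠ 0`, algebraic `c ≠ 0` and
`q ∈ ℚ`, `e^{c·e^β − qβ} ∉ ℚ̄`. PROVED (conditional on the registered open statement
`GelfondExpLogConjecture`, taken as a hypothesis). The conclusion is verbatim the body of
`Summit.Schanuel.Schanuel.Theses.ToricSector.TowerAtom`.
[cite: Waldschmidt1974LNM402, §7.5 Conjecture 7.5.3 (case n = m = 1)] -/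
theorem towerAtom_of_gelfondExpLogConjecture (h : GelfondExpLogConjecture) :
    ∀ (β c : ℂ) (q : ℚ), IsAlgebraic ℚ β → β ≠ 0 → IsAlgebraic ℚ c → c ≠ 0 →
      ¬ IsAlgebraic ℚ (Complex.exp (c * Complex.exp β - (q : ℂ) * β)) := by
  intro β c q hβ hβ0 hc hc0 halg
  set ℓ : ℂ := c * cexp β - (q : ℂ) * β with hℓ_def
  have hq : IsAlgebraic ℚ ((q : ℂ)) := by
    simpa using isAlgebraic_algebraMap (R := ℚ) (A := ℂ) q
  -- `ℓ ≠ 0` by Hermite–Lindemann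
  have hℓ0 : ℓ ≠ 0 := by
    intro h0
    have hmul : c * cexp β = (q : ℂ) * β := sub_eq_zero.mp h0
    have he : cexp β = c⁻¹ * ((q : ℂ) * β) := by
      rw [← hmul, ← mul_assoc, inv_mul_cancel₀ hc0, one_mul]
    apply transcendental_exp_holds hβ hβ0
    rw [he]
    exact hc.inv.mul (hq.mul hβ)
  -- the conjecture at `n = m = 1`
  have hAI : AlgebraicIndependent ℚ (Fin.append (cexp ∘ (![β] : Fin 1 → ℂ)) (![ℓ] : Fin 1 → ℂ)) :=
    h 1 1 ![β] ![ℓ] (fun i => by fin_cases i; simpa using hβ) (linearIndependent_unique_iff.mpr hβ0)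
      (fun j => by fin_cases j; simpa using halg) (linearIndependent_unique_iff.mpr hℓ0)
  have hfam : Fin.append (cexp ∘ (![β] : Fin 1 → ℂ)) (![ℓ] : Fin 1 → ℂ) = ![cexp β, ℓ] := by
    funext i
    fin_cases i <;> rfl
  rw [hfam] at hAI
  -- pass to the subalgebra `ℚ̄ ⊆ ℂ` of algebraic numbers
  set K := Subalgebra.algebraicClosure ℚ ℂ with hK
  have hAI' : AlgebraicIndependent K ![cexp β, ℓ] := hAI.subalgebraAlgebraicClosure
  -- the relation `X₁ − c X₀ + qβ = 0` over `K`
  let c' : K := ⟨c, hc⟩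
  let d' : K := ⟨(q : ℂ) * β, hq.mul hβ⟩
  let P : MvPolynomial (Fin 2) K :=
    MvPolynomial.X 1 - MvPolynomial.C c' * MvPolynomial.X 0 + MvPolynomial.C d'
  have hP : MvPolynomial.aeval ![cexp β, ℓ] P = 0 := by
    simp only [P, map_add, map_sub, map_mul, MvPolynomial.aeval_X, MvPolynomial.aeval_C,
      Matrix.cons_val_one, Matrix.cons_val_zero]
    change ℓ - c * cexp β + (q : ℂ) * β = 0
    rw [hℓ_def]
    ring
  have hP0 : P = 0 := hAI' (by rw [hP, map_zero])
  have h1 := congrArg (MvPolynomial.eval ![(0 : K), 0]) hP0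
  have h2 := congrArg (MvPolynomial.eval ![(0 : K), 1]) hP0
  simp only [P, map_add, map_sub, map_mul, MvPolynomial.eval_X, MvPolynomial.eval_C,
    Matrix.cons_val_one, Matrix.cons_val_zero, map_zero, mul_zero,
    sub_zero, zero_add] at h1 h2
  rw [h1, add_zero] at h2
  exact one_ne_zero h2

end Literature.NumberTheory.Transcendental

end
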